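import Summits.Langlands.Langlands.Theses.SplitPrimeInduction
import Literature.NumberTheory.Automorphic.GKModulesAdmissible
import Literature.NumberTheory.GaloisRepresentations.IntegralGaloisActionProofs

/-!
# Refutation of `SplitPrimeInduction.Deinduction` (stmt-Langlands-16822)

The de-induction support item lets its hypothesis hold off a finite exceptional set `T`
(chosen per twist `χ`), but its conclusion asks for the Frobenius data `P w` at EVERY place
not above `S`.  Frobenius data that is genuine off one place `v₀` and junk at `v₀` therefore
satisfies the hypothesis and violates the conclusion.
-/

section buildfix_record -- buildfix lane 2026-08-19: re-created record(s) of dropped route item(s), see docstring(s)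
open scoped BigOperators Topology Manifold Classical MeasureTheory ProbabilityTheory Matrix InnerProductSpace ComplexConjugate ContinuousMap
open Filter Set Function TopologicalSpace MeasureTheory
namespace Summit.Langlands.Langlands.Theses.SplitPrimeInduction

/-- **Record of the dropped route item `Deinduction`** = stmt-Langlands-16822 (ledger signature verbatim; NOT a route
item): route SplitPrimeInduction rev 8 (2026-08-17T01:16Z) dropped the refuted support `Deinduction` (refuted-misstated by the theorem below; item closed `refuted`). The declaration `Summit.Langlands.Langlands.Theses.SplitPrimeInduction.Deinduction`
therefore no longer exists in the route file and this accepted module stopped elaborating (stale olean;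
buildfix lane 2026-08-19). Re-created here under its original name so the result keeps building; the
statement of every previously accepted declaration in this file is unchanged. -/
def Deinduction : Prop :=
  ∀ (F : Type) [Field F] [NumberField F] (d : ℕ) (hd : Module.finrank ℚ F = d) (n : ℕ), 1 ≤ n → ∀ (k : Type) [Field k] [IsAlgClosed k] [TopologicalSpace k] [DiscreteTopology k] (S : Finset (IsDedekindDomain.HeightOneSpectrum (NumberField.RingOfIntegers F))) (P : IsDedekindDomain.HeightOneSpectrum (NumberField.RingOfIntegers F) → Polynomial k), (∀ w, (P w).Monic ∧ (P w).natDegree = n) → (∀ (χ : Literature.NumberTheory.GaloisRepresentations.FramedGaloisRep F k 1) (c : IsDedekindDomain.HeightOneSpectrum (NumberField.RingOfIntegers F) → k) (Sχ : Finset (IsDedekindDomain.HeightOneSpectrum (NumberField.RingOfIntegers F))), (∀ w ∉ Sχ, χ.IsUnramifiedAt w ∧ χ.HasFrobCharpolyAt w (Polynomial.X - Polynomial.C (c w))) → ∃ (R : Literature.NumberTheory.GaloisRepresentations.FramedGaloisRep ℚ k (d * n)) (T : Finset (IsDedekindDomain.HeightOneSpectrum (NumberField.RingOfIntegers ℚ))),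 R.toGaloisRep.IsSemisimple ∧ ∀ v ∉ T, (∀ w : IsDedekindDomain.HeightOneSpectrum (NumberField.RingOfIntegers F), w.asIdeal.under (NumberField.RingOfIntegers ℚ) = v.asIdeal → w ∉ S ∧ w ∉ Sχ) → R.IsUnramifiedAt v ∧ R.HasFrobCharpolyAt v (∏ᶠ w ∈ {w : IsDedekindDomain.HeightOneSpectrum (NumberField.RingOfIntegers F) | w.asIdeal.under (NumberField.RingOfIntegers ℚ) = v.asIdeal}, ((P w).scaleRoots (c w)).comp (Polynomial.X ^ w.asIdeal.inertiaDeg (NumberField.RingOfIntegers ℚ)))) → ∃ σ : Literature.NumberTheory.GaloisRepresentations.FramedGaloisRep F k n, ∀ v : IsDedekindDomain.HeightOneSpectrum (NumberField.RingOfIntegers ℚ), (∀ w : IsDedekindDomain.HeightOneSpectrum (NumberField.RingOfIntegers F), w.asIdeal.under (NumberField.RingOfIntegers ℚ) = v.asIdeal → w ∉ S) → ∀ w : IsDedekindDomain.HeightOneSpectrum (NumberField.RingOfIntegers F), w.asIdeal.under (NumberField.RingOfIntegers ℚ) = v.asIdeal → σ.IsUnramifiedAt w ∧ σ.HasFrobCharpolyAt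 w (P w)

end Summit.Langlands.Langlands.Theses.SplitPrimeInduction
end buildfix_record


open Polynomial IsDedekindDomain NumberField
open Literature.NumberTheory.GaloisRepresentations

namespace Summit.Langlands.Langlands.Theorems

/-- Every ring endomorphism of `𝓞 ℚ ≅ ℤ` is the identity. [folklore] -/
private theorem ratInt_ringHom_eq_id (f : 𝓞 ℚ →+* 𝓞 ℚ) : f = RingHom.id _ := by
  refine RingHom.ext fun x => ?_
  have hx : ((Rat.ringOfIntegersEquiv x : ℤ) : 𝓞 ℚ) = x := by
    have h2 := eq_intCast Rat.ringOfIntegersEquiv.symm.toRingHom (Rat.ringOfIntegersEquiv x)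
    rw [RingEquiv.toRingHom_eq_coe, RingEquiv.coe_toRingHom, RingEquiv.symm_apply_apply] at h2
    exact h2.symm
  rw [RingHom.id_apply, ← hx]
  exact map_intCast f _

/-- Hence `𝓞 ℚ` carries a unique `𝓞 ℚ`-algebra structure. [folklore] -/
private theorem ratInt_algebra_eq (inst : Algebra (𝓞 ℚ) (𝓞 ℚ)) : inst = Algebra.id (𝓞 ℚ) :=
  Algebra.algebra_ext _ _ fun r => by
    have h1 := ratInt_ringHom_eq_id (letI := inst; algebraMap (𝓞 ℚ) (𝓞 ℚ))
    have h2 := ratInt_ringHom_eq_id (letI := Algebra.id (𝓞 ℚ); algebraMap (𝓞 ℚ) (𝓞 ℚ))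
    exact (congrArg (fun g : 𝓞 ℚ →+* 𝓞 ℚ => g r) h1).trans
      (congrArg (fun g : 𝓞 ℚ →+* 𝓞 ℚ => g r) h2).symm

/-- `under` along `𝓞 ℚ → 𝓞 ℚ` is the identity (for any algebra structure). [folklore] -/
private theorem ratInt_under (inst : Algebra (𝓞 ℚ) (𝓞 ℚ)) (I : Ideal (𝓞 ℚ)) :
    (letI := inst; I.under (𝓞 ℚ)) = I := by
  obtain rfl := ratInt_algebra_eq inst
  exact Ideal.comap_id I

/-- The inertia degree of a prime of `𝓞 ℚ` over `𝓞 ℚ` is `1` (for any algebra structure).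
[folklore] -/
private theorem ratInt_inertiaDeg (inst : Algebra (𝓞 ℚ) (𝓞 ℚ)) (w : HeightOneSpectrum (𝓞 ℚ)) :
    (letI := inst; w.asIdeal.inertiaDeg (𝓞 ℚ)) = 1 := by
  obtain rfl := ratInt_algebra_eq inst
  haveI : w.asIdeal.LiesOver w.asIdeal := ⟨(Ideal.comap_id _).symm⟩
  have ht := Ideal.inertiaDeg_tower (R := 𝓞 ℚ) w.asIdeal w.asIdeal
  have hpos := Ideal.inertiaDeg_pos w.asIdeal (𝓞 ℚ)
  have h2 : w.asIdeal.inertiaDeg (𝓞 ℚ) * w.asIdeal.inertiaDeg (𝓞 ℚ) =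
      w.asIdeal.inertiaDeg (𝓞 ℚ) * 1 := by rw [mul_one]; exact ht.symm
  exact mul_left_cancel₀ hpos.ne' h2

/-- Refutes `SplitPrimeInduction.Deinduction` [refuted-misstated]: take `F = ℚ`, `d = n = 1`,
`k = ℚ̄` (discrete), `S = ∅`, and Frobenius data `P v₀ = X`, `P w = X - 1` (`w ≠ v₀`) for one
finite place `v₀`.  For every character `χ` (Frobenius values `c` off `Sχ`) the hypothesis is
witnessed by `R := χ`, `T := {v₀}` (charpoly `X - c w = ((X - 1).scaleRoots (c w)).comp (X ^ 1)`
off `v₀`), but the conclusion demands a character `σ` of `Γ_ℚ` whose Frobenius at `v₀` has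
characteristic polynomial `X`, i.e. determinant `0`.  Witness: junk Frobenius datum at a single
place (the hypothesis tolerates a finite exceptional set `T`, the conclusion none).
Repaired statement C′ (believed true, Clifford/Taylor de-induction): mirror the exceptional set
in the conclusion —
`… → ∃ (σ : FramedGaloisRep F k n) (T' : Finset (HeightOneSpectrum (𝓞 ℚ))), ∀ v ∉ T', (∀ w, w.asIdeal.under (𝓞 ℚ) = v.asIdeal → w ∉ S) → ∀ w, w.asIdeal.under (𝓞 ℚ) = v.asIdeal → σ.IsUnramifiedAt w ∧ σ.HasFrobCharpolyAt w (P w)`;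
the witness misses C′ (`σ := 1`, `T' := {v₀}`). [folklore] -/
theorem SplitPrimeInductionDeinduction_refuted :
    ¬ Summit.Langlands.Langlands.Theses.SplitPrimeInduction.Deinduction := by
  intro h
  classical
  -- coefficient field `ℚ̄` with the discrete topology
  letI : TopologicalSpace (AlgebraicClosure ℚ) := ⊥
  haveI : DiscreteTopology (AlgebraicClosure ℚ) := ⟨rfl⟩
  -- one finite place `v₀` of `ℚ`
  obtain ⟨m, hm⟩ := Ideal.exists_maximal (𝓞 ℚ)
  have hm0 : m ≠ ⊥ := Ring.ne_bot_of_isMaximal_of_not_isField hm (RingOfIntegers.not_isField ℚ)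
  let v₀ : HeightOneSpectrum (𝓞 ℚ) := ⟨m, hm.isPrime, hm0⟩
  -- Frobenius data: `X` at `v₀`, `X - 1` elsewhere
  let P : HeightOneSpectrum (𝓞 ℚ) → (AlgebraicClosure ℚ)[X] :=
    fun w => if w = v₀ then X else X - C 1
  have hP : ∀ w, (P w).Monic ∧ (P w).natDegree = 1 := by
    intro w
    by_cases hw : w = v₀
    · simp only [P, if_pos hw]
      exact ⟨monic_X, natDegree_X⟩
    · simp only [P, if_neg hw]
      exact ⟨monic_X_sub_C (1 : AlgebraicClosure ℚ), natDegree_X_sub_C (1 : AlgebraicClosure ℚ)⟩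
  have key := h ℚ 1 (Module.finrank_self ℚ) 1 le_rfl (AlgebraicClosure ℚ) ∅ P hP ?_
  · obtain ⟨σ, hσ⟩ := key
    have h1 := hσ v₀ (fun w _ => Finset.notMem_empty w) v₀ (ratInt_under _ _)
    obtain ⟨𝔓, h𝔓⟩ := HeightOneSpectrum.primesAbove_nonempty v₀
    obtain ⟨τ, hτ⟩ := HeightOneSpectrum.exists_isArithFrobAt_of_mem_primesAbove_holds h𝔓
    have h2 := h1.2 𝔓 h𝔓 τ hτ
    have hX : P v₀ = X := by simp [P]
    rw [hX] at h2
    have hdet := Matrix.det_eq_sign_charpoly_coeff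
      ((σ τ : GL (Fin 1) (AlgebraicClosure ℚ)) : Matrix (Fin 1) (Fin 1) (AlgebraicClosure ℚ))
    change ((σ τ : GL (Fin 1) (AlgebraicClosure ℚ)) :
      Matrix (Fin 1) (Fin 1) (AlgebraicClosure ℚ)).charpoly = X at h2
    rw [h2, coeff_X_zero, mul_zero] at hdet
    refine (Matrix.GeneralLinearGroup.det (σ τ)).ne_zero ?_
    rw [Matrix.GeneralLinearGroup.val_det_apply]
    exact hdet
  · -- the hypothesis: for every twist `χ` take `R := χ`, `T := {v₀}`
    intro χ c Sχ hχ
    refine ⟨χ, {v₀}, ?_, ?_⟩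
    · -- a one-dimensional representation is semisimple
      haveI : Representation.IsIrreducible (FramedRep.toContinuousRep χ).toRepresentation :=
        Literature.NumberTheory.Automorphic.isIrreducible_of_finrank_eq_one' _ (by simp)
      show (FramedRep.toContinuousRep χ).toRepresentation.IsSemisimpleRepresentation
      infer_instance
    · intro v hv hguard
      have hv' : v ≠ v₀ := fun e => hv (Finset.mem_singleton.2 e)
      have hvS : v ∉ Sχ := (hguard v (ratInt_under _ _)).2
      obtain ⟨hunr, hchar⟩ := hχ v hvS
      refine ⟨hunr, ?_⟩
      convert hchar using 2
      simp_rw [ratInt_under, ratInt_inertiaDeg, pow_one, comp_X]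
      rw [show {w : HeightOneSpectrum (𝓞 ℚ) | w.asIdeal = v.asIdeal} = {v} from
        Set.ext fun w => by rw [Set.mem_setOf_eq, Set.mem_singleton_iff, HeightOneSpectrum.ext_iff],
        finprod_mem_singleton]
      simp only [P, if_neg hv', X_sub_C_scaleRoots, one_mul]

end Summit.Langlands.Langlands.Theorems
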